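import Literature.Geometry.GeometricMeasureTheory.CurrentsAdmissibleHomotopy
import HarnessLib

/-!
# The admissible push-forward and homotopy of a cycle, in every degree

Support file for the proof of the named fact
`Literature.Geometry.GeometricMeasureTheory.Federer1969_compactness_integralCurrents`
(Federer–Fleming compactness, [Federer1969, 4.2.17 (2)]). The deformation theorem 4.2.9 will be
applied to CYCLES `T` (`∂T = 0`; the general case is reduced to it by subtracting the cone over
`∂T`), where Federer's formulas of 4.2.2 simplify to `∂(g_{#v} T) = 0` and
`(g₂)_{#v} T − (g₁)_{#v} T = ∂ H_v(g₁, g₂) T`. The homotopy formula of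
`CurrentsAdmissibleHomotopy.lean` was proved in degree `≥ 2` (it involves the homotopy of `∂T`);
for cycles we prove both formulas in EVERY degree `d + 1 ≥ 1`, which is what the deformation of
`1`-cycles needs:

* `Current.mass_lipHomotopyError_le` — for a normal `T` of degree `m + 1 ≥ 1` and Lipschitz `F, G`
  with `‖G − F‖ ≤ η`: `𝐌(G_# T − F_# T − ∂ H(F,G) T) ≤ η (5 max Lip)^m 𝐌(∂T)` (the error is the weak
  limit of the smooth `hₙ_# ([0,1] × ∂T)`, [Federer1969, 4.1.9]; lower semicontinuity of mass);
  `Current.mass_boundary_lipPushforward_le'` — `𝐌(∂ F_# T) ≤ Lip(F)^m 𝐌(∂T)`.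
* `Current.exists_goodSeq_decay'` (with `tendsto_tailWeight'`, `variation_sublevel_le_weighted'`,
  `extConst_pow_mul_le'`) — good sequences with slice decay `(extConst r_j)^d 𝐌⟨S, v, r_j+⟩ → 0` for
  `S` of degree `d + 1` with `∫ (1/v)^{d+1} d‖S‖ < ∞` (degree-shifted copy of Part C1 of
  `CurrentsAdmissibleHomotopy.lean`, [Federer1969, 4.2.2: "lim inf r^{1−m} 𝐌⟨T,u,r+⟩ = 0"]).
* `Current.boundary_admPushLim_of_cycle` — **`∂(g_{#v} S) = 0`** for a cycle `S`;
  `Current.admPushLim_sub_admPushLim_eq_of_cycle` — **`(g₂)_{#v} S − (g₁)_{#v} S = ∂ H_v(g₁,g₂) S`**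
  (at a good radius `∂(S ⌞ {v > r}) = −⟨S, v, r+⟩`, so the boundary / error currents have mass
  `≤ c (extConst r)^d 𝐌⟨S, v, r+⟩ → 0` along the decaying good sequence; independence of the good
  sequence, `admPushLim_eq`, `admHomLim_eq`).

Theorems only; no new definitions, no named facts.

## References

* H. Federer, *Geometric Measure Theory*, Springer 1969, 4.1.9, 4.1.14, 4.2.1, 4.2.2, 4.2.9 (held copy
  `lit book:federernd-geometric-measure-theory`, PDF pp. 318–320, 334–337, 343–345) [Federer1969].
-/

noncomputable section

open scoped Distributions ENNReal NNReal Topology ContDiff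
open MeasureTheory TopologicalSpace Set Filter Metric Function
open scoped InnerProductSpace

namespace Literature.Geometry.GeometricMeasureTheory

set_option maxSynthPendingDepth 2

section LipError

variable {E E' : Type*} [NormedAddCommGroup E] [NormedSpace ℝ E] [FiniteDimensional ℝ E]
  [NormedAddCommGroup E'] [NormedSpace ℝ E'] [FiniteDimensional ℝ E']
  {Ω : Opens E} {Ω' : Opens E'} {m : ℕ}

namespace Current

variable (T : Current Ω (m + 1)) (hT : T.mass ≠ ⊤) (hdT : T.boundary.mass ≠ ⊤)
  (hsupp : IsCompact T.support) {F G : E → E'} {LF LG : ℝ≥0} (hF : LipschitzWith LF F)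
  (hG : LipschitzWith LG G) {η : ℝ} (hη : 0 ≤ η) (hclose : ∀ x, ‖G x - F x‖ ≤ η)

include hη hclose in
/-- **The error current of the Lipschitz homotopy formula has mass `≤ η (5 max Lip)^m 𝐌(∂T)`**, in
every degree `m + 1 ≥ 1`: `𝐌(G_# T − F_# T − ∂ H(F,G) T) ≤ η (5 max(Lip F, Lip G))^m 𝐌(∂T)` (the error
is the weak limit of the smooth homotopy push-forwards `hₙ_# ([0,1] × ∂T)` of the affine homotopy
formula, whose masses are so bounded; lower semicontinuity of mass). For a cycle the error vanishes.
[cite: Federer1969, 4.1.9, 4.1.14] -/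
theorem mass_lipHomotopyError_le :
    (T.lipPushforward hT hdT hsupp hG Ω' - T.lipPushforward hT hdT hsupp hF Ω' -
        (T.lipHomotopy hT hdT hsupp hF hG hη hclose Ω').boundary).mass ≤
      ENNReal.ofReal (η * (5 * max (LF : ℝ) LG) ^ m) * T.boundary.mass := by
  obtain ⟨hUo, hTU, hχ1, hχabs⟩ := T.cutoff_spec hsupp
  obtain ⟨hVo, h01, hρ1, hρabs, hρ2⟩ := timeCutoff_spec
  set L : ℝ := max (LF : ℝ) LG
  have hL : 0 ≤ L := le_max_of_le_left LF.coe_nonneg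
  -- the smooth error currents
  set En : ℕ → Current Ω' (m + 1) := fun n =>
    (T.boundary.prodInterval 0 1).pushforward Ω' (TestFunction.tensorCutoff timeCutoff (T.cutoff hsupp))
      (contDiff_affineHomotopy (contDiff_lipApprox hF n) (contDiff_lipApprox hG n)) with hEn
  have hform : ∀ (n : ℕ) (φ : TestForm Ω' (m + 1)), T.lipPushSeq hsupp hG Ω' n φ - T.lipPushSeq hsupp hF Ω' n φ -
      T.lipHomotopySeq hsupp hF hG Ω' n (TestForm.extDerivCLM φ) = En n φ := by
    intro n φ
    have h := T.homotopy_formula_affine (Ω' := Ω') (T.cutoff hsupp) timeCutoff (contDiff_lipApprox hF n)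
      (contDiff_lipApprox hG n) hUo hTU hχ1 hVo h01 hρ1
    have h' := DFunLike.congr_fun h φ
    simp only [Current.lipPushSeq, Current.lipHomotopySeq, hEn]
    rw [sub_eq_iff_eq_add']
    simpa [Current.boundary_apply] using h'
  have htend : ∀ φ : TestForm Ω' (m + 1), Tendsto (fun n => En n φ) atTop
      (𝓝 ((T.lipPushforward hT hdT hsupp hG Ω' - T.lipPushforward hT hdT hsupp hF Ω' -
        (T.lipHomotopy hT hdT hsupp hF hG hη hclose Ω').boundary) φ)) := by
    intro φ
    have hl := ((T.tendsto_lipPushSeq hT hdT hsupp hG φ).sub (T.tendsto_lipPushSeq hT hdT hsupp hF φ)).sub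
      (T.tendsto_lipHomotopySeq hT hdT hsupp hF hG hη hclose (TestForm.extDerivCLM φ))
    exact (hl.congr fun n => hform n φ)
  have hmass : ∀ n : ℕ, (En n).mass ≤ ENNReal.ofReal ((η + 2 / ((n : ℝ) + 1)) * (5 * L) ^ m) * T.boundary.mass := by
    intro n
    refine T.boundary.mass_affineHomotopy_le _ _ (contDiff_lipApprox hF n) (contDiff_lipApprox hG n)
      (by positivity) hρabs fun t ht x _ => ?_
    have h1 : ‖fderiv ℝ (lipApprox hF n) x + t • (fderiv ℝ (lipApprox hG n) x - fderiv ℝ (lipApprox hF n) x)‖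
        ≤ 5 * L := by
      calc _ ≤ ‖fderiv ℝ (lipApprox hF n) x‖ + ‖t • (fderiv ℝ (lipApprox hG n) x - fderiv ℝ (lipApprox hF n) x)‖ :=
            norm_add_le _ _
        _ ≤ L + |t| * (L + L) := by
            rw [norm_smul, Real.norm_eq_abs]
            refine add_le_add ((norm_fderiv_lipApprox_le hF n x).trans (le_max_left _ _))
              (mul_le_mul_of_nonneg_left ?_ (abs_nonneg _))
            exact (norm_sub_le _ _).trans (add_le_add
              ((norm_fderiv_lipApprox_le hG n x).trans (le_max_right _ _))
              ((norm_fderiv_lipApprox_le hF n x).trans (le_max_left _ _)))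
        _ ≤ L + 2 * (L + L) := by have := hρ2 t ht; nlinarith
        _ = 5 * L := by ring
    calc |T.cutoff hsupp x| * ‖lipApprox hG n x - lipApprox hF n x‖ *
          ‖fderiv ℝ (lipApprox hF n) x + t • (fderiv ℝ (lipApprox hG n) x - fderiv ℝ (lipApprox hF n) x)‖ ^ m
        ≤ 1 * (η + 2 / ((n : ℝ) + 1)) * (5 * L) ^ m := by
          refine mul_le_mul (mul_le_mul (hχabs x) (norm_lipApprox_sub_lipApprox_le hF hG hclose n x)
            (norm_nonneg _) zero_le_one) (pow_le_pow_left₀ (norm_nonneg _) h1 _) (by positivity)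
            (by positivity)
      _ = (η + 2 / ((n : ℝ) + 1)) * (5 * L) ^ m := by ring
  have hlim : Tendsto (fun n : ℕ => ENNReal.ofReal ((η + 2 / ((n : ℝ) + 1)) * (5 * L) ^ m) * T.boundary.mass)
      atTop (𝓝 (ENNReal.ofReal (η * (5 * L) ^ m) * T.boundary.mass)) := by
    refine ENNReal.Tendsto.mul_const (ENNReal.tendsto_ofReal ?_) (Or.inr hdT)
    have h2 : Tendsto (fun n : ℕ => 2 / ((n : ℝ) + 1)) atTop (𝓝 0) := tendsto_const_div_add_one 2
    have := ((tendsto_const_nhds (x := η)).add h2).mul_const ((5 * L) ^ m)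
    rwa [add_zero] at this
  refine (Current.mass_le_liminf htend).trans ?_
  rw [← hlim.liminf_eq]
  exact liminf_le_liminf (Eventually.of_forall hmass)

/-- **Boundary mass of the Lipschitz push-forward in every degree**:
`𝐌(∂(F_# T)) ≤ Lip(F)^m 𝐌(∂T)` (`∂(fₙ_# T) = fₙ_# ∂T`, lower semicontinuity).
[cite: Federer1969, 4.1.14] -/
theorem mass_boundary_lipPushforward_le' :
    (T.lipPushforward hT hdT hsupp hF Ω').boundary.mass ≤ (LF : ℝ≥0∞) ^ m * T.boundary.mass := by
  obtain ⟨hUo, hTU, hχ1, hχabs⟩ := T.cutoff_spec hsupp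
  have htend : ∀ ψ : TestForm Ω' m, Tendsto (fun n => (T.boundary.pushforward Ω' (T.cutoff hsupp)
      (contDiff_lipApprox hF n)) ψ) atTop (𝓝 ((T.lipPushforward hT hdT hsupp hF Ω').boundary ψ)) := by
    intro ψ
    rw [Current.boundary_apply]
    refine (T.tendsto_lipPushSeq hT hdT hsupp hF (TestForm.extDerivCLM ψ)).congr fun n => ?_
    have := T.boundary_pushforward (Ω' := Ω') (T.cutoff hsupp) (contDiff_lipApprox hF n) hUo hTU hχ1
    have h' := DFunLike.congr_fun this ψ
    rw [Current.boundary_apply] at h'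
    exact h'
  refine (Current.mass_le_liminf htend).trans ?_
  refine liminf_le_of_frequently_le' (Frequently.of_forall fun n => ?_)
  exact T.boundary.mass_pushforward_le hχabs (contDiff_lipApprox hF n) fun x _ => norm_fderiv_lipApprox_le hF n x

end Current

end LipError


/-! ### Slice decay in every degree (degree-shifted copy of Part C1 of `CurrentsAdmissibleHomotopy`) -/

section SliceDecayGeneral

variable {V : Type*} [NormedAddCommGroup V] [InnerProductSpace ℝ V] [FiniteDimensional ℝ V]
  [MeasurableSpace V] [BorelSpace V] {n d : ℕ} {v : V → ℝ} {C : ℝ}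
  {S : Current (⊤ : Opens V) (d + 1)}

variable (hS : S.mass ≠ ⊤) (hdS : S.boundary.mass ≠ ⊤) (hv : LipschitzWith 1 v) {ε : ℝ} (hε : 0 < ε)
  (hI : ∫⁻ x, admWeight v d x ∂S.variation ≠ ⊤)

include hS hv hε hI in
/-- The tail weights `W_j = ∫_{v ≤ 2ε/2^j} (1/v)^{d+2} d‖S‖ → 0`. [folklore] -/
theorem Current.tendsto_tailWeight' :
    Tendsto (fun j : ℕ => ∫⁻ x in {x | v x ≤ 2 * ε / 2 ^ j}, admWeight v d x ∂S.variation) atTop (𝓝 0) := by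
  have h0 : S.variation {x | v x ≤ 0} = 0 := by
    by_contra hne
    apply hI
    refine eq_top_iff.2 (le_trans ?_ (setLIntegral_le_lintegral {x | v x ≤ 0} _))
    have : ∫⁻ x in {x | v x ≤ 0}, admWeight v d x ∂S.variation = ∫⁻ _ in {x | v x ≤ 0}, ⊤ ∂S.variation :=
      setLIntegral_congr_fun (isClosed_le hv.continuous continuous_const).measurableSet fun x hx =>
        admWeight_eq_top hx
    rw [this, setLIntegral_const, ENNReal.top_mul hne]
  exact tendsto_setLIntegral_zero (μ := S.variation) hI
    (S.tendsto_variation_sublevel_of_null hS hv.continuous (by positivity : 0 < 2 * ε) h0)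

include hv in
/-- **Weighted bound of a sublevel mass**: `‖S‖{v ≤ c} ≤ c^{d+2} ∫_{v ≤ c} (1/v)^{d+2} d‖S‖` (`c > 0`;
`‖S‖{v ≤ 0} = 0`). [cite: Federer1969, 4.2.2] -/
theorem Current.variation_sublevel_le_weighted' {c : ℝ} (hc : 0 < c) :
    S.variation {x | v x ≤ c} ≤ ENNReal.ofReal (c ^ (d + 1)) * ∫⁻ x in {x | v x ≤ c}, admWeight v d x ∂S.variation := by
  rw [← lintegral_const_mul _ (measurable_admWeight hv.continuous), ← setLIntegral_one]
  refine setLIntegral_mono (measurable_const.mul (measurable_admWeight hv.continuous)) fun x hx => ?_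
  have hx' : v x ≤ c := hx
  -- `1 ≤ c^{d+2} (1/v)^{d+2}` where `v ≤ c` (both sides `∞`-safe)
  unfold admWeight
  rcases le_or_gt (v x) 0 with h0 | hpos
  · rw [ENNReal.ofReal_of_nonpos h0, ENNReal.inv_zero, ENNReal.top_pow (Nat.succ_ne_zero _),
      ENNReal.mul_top (by positivity : ENNReal.ofReal (c ^ (d + 1)) ≠ 0)]
    exact le_top
  · rw [← ENNReal.ofReal_inv_of_pos hpos, ← ENNReal.ofReal_pow (by positivity), ← ENNReal.ofReal_mul (by positivity),
      ← ENNReal.ofReal_one]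
    refine ENNReal.ofReal_le_ofReal ?_
    rw [← mul_pow, show (1 : ℝ) = 1 ^ (d + 1) by simp]
    refine pow_le_pow_left₀ zero_le_one ?_ _
    rw [le_mul_inv_iff₀ hpos, one_mul]
    exact hx'

omit [FiniteDimensional ℝ V] [MeasurableSpace V] [BorelSpace V] in
/-- `(extConst r)^{d+1} ℓ^{d+1} ≤ (2√n C)^{d+1}` for `0 < ℓ ≤ r`. [folklore] -/
theorem extConst_pow_mul_le' (hC : 0 ≤ C) {r ℓ : ℝ} (hr : 0 < r) (hℓ : 0 < ℓ) (hℓr : ℓ ≤ r) :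
    (extConst n C r : ℝ≥0∞) ^ d * ENNReal.ofReal (ℓ ^ d) ≤
      ENNReal.ofReal ((2 * Real.sqrt n * C) ^ d) := by
  have he : (extConst n C r : ℝ≥0∞) = ENNReal.ofReal (Real.sqrt n * (C / (r / 2))) := by
    rw [← ENNReal.ofReal_coe_nnreal]
    unfold extConst
    rw [NNReal.coe_mul, Real.coe_sqrt, NNReal.coe_natCast, Real.coe_toNNReal _ (div_nonneg hC (half_pos hr).le)]
  rw [he, ← ENNReal.ofReal_pow (by positivity), ← ENNReal.ofReal_mul (by positivity), ← mul_pow]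
  refine ENNReal.ofReal_le_ofReal (pow_le_pow_left₀ (by positivity) ?_ _)
  rw [show Real.sqrt n * (C / (r / 2)) * ℓ = 2 * Real.sqrt n * C * (ℓ / r) by field_simp]
  have : ℓ / r ≤ 1 := (div_le_one hr).2 hℓr
  have h0 : 0 ≤ 2 * Real.sqrt n * C := by positivity
  nlinarith

include hS hdS hε hI in
/-- **Good sequences with slice decay**: for a normal `S` with `∫ (1/v)^{d+2} d‖S‖ < ∞` there is a good
sequence along which `(extConst r_j)^{d+1} 𝐌⟨S, v, r_j+⟩ → 0`, satisfying moreover any prescribed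
a.e. property `Q` [Federer1969, 4.2.2: "`lim inf_{r→0+} r^{1-m} 𝐌⟨T, u, r+⟩ = 0`"]. The radii are
selected in the dyadic intervals by Markov's inequality applied to a measurable slice majorant.
[cite: Federer1969, 4.2.2] -/
theorem Current.exists_goodSeq_decay' (hC : 0 ≤ C) {Q : ℝ → Prop} (hQ : ∀ᵐ r ∂(volume : Measure ℝ), Q r) :
    ∃ (P : ℝ → Prop) (R : S.GoodSeq hS hv.continuous ε P), (∀ j, Q (R.r j)) ∧
      Tendsto (fun j => (extConst n C (R.r j) : ℝ≥0∞) ^ d *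
        ((S.isRepresentable_of_mass_ne_top hS).slice (S.boundary.isRepresentable_of_mass_ne_top hdS)
          hv.continuous (R.r j)).mass) atTop (𝓝 0) := by
  obtain ⟨G, hGm, hGae, hGint⟩ := (S.isRepresentable_of_mass_ne_top hS).exists_measurable_slice_majorant
    (S.boundary.isRepresentable_of_mass_ne_top hdS) hv
  -- data
  have hℓpos : ∀ j : ℕ, 0 < ε / 2 ^ (j + 1) := fun j => by positivity
  have hℓ2 : ∀ j : ℕ, ε / 2 ^ j = 2 * (ε / 2 ^ (j + 1)) := fun j => by rw [pow_succ]; field_simp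
  have hℓ4 : ∀ j : ℕ, 4 * (ε / 2 ^ (j + 1)) = 2 * ε / 2 ^ j := fun j => by rw [pow_succ]; field_simp; ring
  set W : ℕ → ℝ≥0∞ := fun j => ∫⁻ x in {x | v x ≤ 2 * ε / 2 ^ j}, admWeight v d x ∂S.variation with hW
  have hWfin : ∀ j, W j ≠ ⊤ := fun j => ne_top_of_le_ne_top hI (setLIntegral_le_lintegral _ _)
  set cS : ℝ≥0∞ := ENNReal.ofReal (sliceConst d) * ENNReal.ofReal ((1 : ℝ≥0) : ℝ) with hcS
  have hcSfin : cS ≠ ⊤ := ENNReal.mul_ne_top ENNReal.ofReal_ne_top ENNReal.ofReal_ne_top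
  set κ : ℕ → ℝ≥0∞ := fun j => 4 ^ (d + 2) * (cS * W j) + ENNReal.ofReal (1 / 2 ^ j) with hκ
  set θ : ℕ → ℝ≥0∞ := fun j => ENNReal.ofReal ((ε / 2 ^ (j + 1)) ^ d) * κ j with hθ
  -- the integral of `G` over `I_j`
  have hGI : ∀ j : ℕ, ∫⁻ r in Set.Ioc (ε / 2 ^ (j + 1)) (ε / 2 ^ j), G r ≤
      4 ^ (d + 1) * (ENNReal.ofReal ((ε / 2 ^ (j + 1)) ^ (d + 1)) * (cS * W j)) := by
    intro j
    rw [← setLIntegral_congr Ioo_ae_eq_Ioc]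
    refine (hGint _ _ (hℓpos j)).trans ?_
    have hsub : v ⁻¹' Set.Icc (ε / 2 ^ (j + 1) - ε / 2 ^ (j + 1)) (ε / 2 ^ j + ε / 2 ^ (j + 1)) ⊆
        {x | v x ≤ 4 * (ε / 2 ^ (j + 1))} := fun x hx => by
      simp only [Set.mem_preimage, Set.mem_Icc] at hx
      show v x ≤ 4 * (ε / 2 ^ (j + 1))
      linarith [hx.2, hℓ2 j, hℓpos j]
    calc cS * S.variation (v ⁻¹' Set.Icc (ε / 2 ^ (j + 1) - ε / 2 ^ (j + 1)) (ε / 2 ^ j + ε / 2 ^ (j + 1)))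
        ≤ cS * S.variation {x | v x ≤ 4 * (ε / 2 ^ (j + 1))} := mul_le_mul' le_rfl (measure_mono hsub)
      _ ≤ cS * (ENNReal.ofReal ((4 * (ε / 2 ^ (j + 1))) ^ (d + 1)) *
            ∫⁻ x in {x | v x ≤ 4 * (ε / 2 ^ (j + 1))}, admWeight v d x ∂S.variation) :=
          mul_le_mul' le_rfl (S.variation_sublevel_le_weighted' hv (by positivity))
      _ = 4 ^ (d + 1) * (ENNReal.ofReal ((ε / 2 ^ (j + 1)) ^ (d + 1)) * (cS * W j)) := by
          rw [mul_pow, ENNReal.ofReal_mul (by positivity), ENNReal.ofReal_pow (by norm_num : (0:ℝ) ≤ 4),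
            ENNReal.ofReal_ofNat, hℓ4 j]
          simp only [hW]
          ring
  -- Markov: `G < θ_j` frequently on `I_j`
  have hfreq : ∀ j : ℕ, ∃ᵐ r ∂(volume : Measure ℝ), r ∈ Set.Ioc (ε / 2 ^ (j + 1)) (ε / 2 ^ j) ∧ G r < θ j := by
    intro j
    apply frequently_of_measure_compl_lt
    have hIvol : volume (Set.Ioc (ε / 2 ^ (j + 1)) (ε / 2 ^ j)) = ENNReal.ofReal (ε / 2 ^ (j + 1)) := by
      rw [Real.volume_Ioc]; congr 1; linarith [hℓ2 j]
    rw [hIvol]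
    by_contra hge
    rw [not_lt] at hge
    have hM := mul_meas_ge_le_lintegral (μ := volume.restrict (Set.Ioc (ε / 2 ^ (j + 1)) (ε / 2 ^ j))) hGm (θ j)
    have h1 : ENNReal.ofReal (ε / 2 ^ (j + 1)) ≤
        (volume.restrict (Set.Ioc (ε / 2 ^ (j + 1)) (ε / 2 ^ j))) {r | θ j ≤ G r} := by
      rw [Measure.restrict_apply (measurableSet_le measurable_const hGm)]
      refine hge.trans (measure_mono fun r hr => ⟨?_, hr.1⟩)
      exact not_lt.1 hr.2
    have h2 : θ j * ENNReal.ofReal (ε / 2 ^ (j + 1)) ≤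
        4 ^ (d + 1) * (ENNReal.ofReal ((ε / 2 ^ (j + 1)) ^ (d + 1)) * (cS * W j)) :=
      (mul_le_mul' le_rfl h1).trans (hM.trans (hGI j))
    -- rewrite the left side
    set X := ENNReal.ofReal ((ε / 2 ^ (j + 1)) ^ (d + 1)) * (cS * W j) with hX
    have hXfin : X ≠ ⊤ := ENNReal.mul_ne_top ENNReal.ofReal_ne_top (ENNReal.mul_ne_top hcSfin (hWfin j))
    set Y := ENNReal.ofReal ((ε / 2 ^ (j + 1)) ^ (d + 1)) * ENNReal.ofReal (1 / 2 ^ j) with hY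
    have hY0 : Y ≠ 0 := mul_ne_zero (ENNReal.ofReal_pos.2 (by positivity)).ne' (ENNReal.ofReal_pos.2 (by positivity)).ne'
    have hmul : ENNReal.ofReal ((ε / 2 ^ (j + 1)) ^ d) * ENNReal.ofReal (ε / 2 ^ (j + 1)) =
        ENNReal.ofReal ((ε / 2 ^ (j + 1)) ^ (d + 1)) := by
      rw [← ENNReal.ofReal_mul (by positivity), ← pow_succ]
    have hLHS : θ j * ENNReal.ofReal (ε / 2 ^ (j + 1)) = 4 ^ (d + 2) * X + Y := by
      have h' : θ j * ENNReal.ofReal (ε / 2 ^ (j + 1)) = ENNReal.ofReal ((ε / 2 ^ (j + 1)) ^ (d + 1)) * κ j := by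
        simp only [hθ]
        rw [mul_right_comm, hmul]
      rw [h']
      simp only [hκ, hX, hY]
      ring
    rw [hLHS] at h2
    have h3 : 4 ^ (d + 1) * X < 4 ^ (d + 2) * X + Y := by
      calc 4 ^ (d + 1) * X ≤ 4 ^ (d + 2) * X :=
            mul_le_mul' (pow_le_pow_right₀ (by norm_num : (1 : ℝ≥0∞) ≤ 4) (Nat.le_succ _)) le_rfl
        _ < 4 ^ (d + 2) * X + Y := ENNReal.lt_add_right (ENNReal.mul_ne_top (ENNReal.pow_ne_top (by simp)) hXfin) hY0
    exact (lt_irrefl _) (h3.trans_le h2)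
  -- the good sequence
  set P : ℝ → Prop := fun r => (∀ j : ℕ, r ∈ Set.Ioc (ε / 2 ^ (j + 1)) (ε / 2 ^ j) → G r < θ j) ∧ Q r ∧
    ((S.isRepresentable_of_mass_ne_top hS).slice (S.boundary.isRepresentable_of_mass_ne_top hdS)
      hv.continuous r).mass ≤ G r with hP
  have hfreqP : ∀ j : ℕ, ∃ᵐ r ∂(volume : Measure ℝ), r ∈ Set.Ioc (ε / 2 ^ (j + 1)) (ε / 2 ^ j) ∧ P r := by
    intro j
    refine ((hfreq j).and_eventually (hQ.and hGae)).mono fun r hr => ⟨hr.1.1, fun j' hj' => ?_, hr.2.1, hr.2.2⟩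
    rw [dyadic_unique hε hj' hr.1.1]
    exact hr.1.2
  obtain ⟨R⟩ := S.exists_goodSeq_of_frequently hS hdS hv hfreqP
  refine ⟨P, R, fun j => (R.prop j).2.1, ?_⟩
  -- decay
  have hκ0 : Tendsto κ atTop (𝓝 0) := by
    have h1 : Tendsto (fun j => 4 ^ (d + 2) * (cS * W j)) atTop (𝓝 0) := by
      have hW0 := S.tendsto_tailWeight' hS hv hε hI
      have := ENNReal.Tendsto.const_mul (a := 4 ^ (d + 2) * cS) hW0
        (Or.inr (ENNReal.mul_ne_top (ENNReal.pow_ne_top (by simp)) hcSfin))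
      simp only [mul_zero] at this
      simpa [mul_assoc] using this
    have h2 : Tendsto (fun j : ℕ => ENNReal.ofReal (1 / 2 ^ j)) atTop (𝓝 0) := by
      rw [← ENNReal.ofReal_zero]
      refine ENNReal.tendsto_ofReal ?_
      have := tendsto_pow_atTop_nhds_zero_of_lt_one (by norm_num : (0:ℝ) ≤ 1 / 2) (by norm_num)
      exact this.congr fun j => by rw [one_div, inv_pow, one_div]
    rw [show (0 : ℝ≥0∞) = 0 + 0 by simp]
    exact h1.add h2
  have hbound : ∀ j, (extConst n C (R.r j) : ℝ≥0∞) ^ d *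
      ((S.isRepresentable_of_mass_ne_top hS).slice (S.boundary.isRepresentable_of_mass_ne_top hdS)
        hv.continuous (R.r j)).mass ≤ ENNReal.ofReal ((2 * Real.sqrt n * C) ^ d) * κ j := by
    intro j
    have hPj := R.prop j
    have hGθ : G (R.r j) < θ j := hPj.1 j ⟨R.lower j, R.upper j⟩
    calc _ ≤ (extConst n C (R.r j) : ℝ≥0∞) ^ d * θ j :=
          mul_le_mul' le_rfl (hPj.2.2.trans hGθ.le)
      _ = (extConst n C (R.r j) : ℝ≥0∞) ^ d * ENNReal.ofReal ((ε / 2 ^ (j + 1)) ^ d) * κ j := by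
          simp only [hθ, mul_assoc]
      _ ≤ ENNReal.ofReal ((2 * Real.sqrt n * C) ^ d) * κ j :=
          mul_le_mul' (extConst_pow_mul_le' hC (R.pos hε j) (hℓpos j) (R.lower j).le) le_rfl
  have hlim : Tendsto (fun j => ENNReal.ofReal ((2 * Real.sqrt n * C) ^ d) * κ j) atTop (𝓝 0) := by
    have := ENNReal.Tendsto.const_mul (a := ENNReal.ofReal ((2 * Real.sqrt n * C) ^ d)) hκ0
      (Or.inr ENNReal.ofReal_ne_top)
    rwa [mul_zero] at this
  exact tendsto_of_tendsto_of_tendsto_of_le_of_le tendsto_const_nhds hlim (fun j => bot_le) hbound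

end SliceDecayGeneral

/-! ### Cycle formulas for the admissible push-forward and homotopy (every degree) -/

section AdmissibleCycle

variable {V : Type*} [NormedAddCommGroup V] [InnerProductSpace ℝ V] [FiniteDimensional ℝ V]
  [MeasurableSpace V] [BorelSpace V] {n d : ℕ} {v : V → ℝ} {g g₁ g₂ : V → V} {C : ℝ}
  {S : Current (⊤ : Opens V) (d + 1)}

variable (b : OrthonormalBasis (Fin n) ℝ V) (hS : S.mass ≠ ⊤) (hcyc : S.boundary = 0)
  (hsupp : IsCompact S.support) (hv : LipschitzWith 1 v) (hadm : Admissible v g C)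
  (h₁ : Admissible v g₁ C) (h₂ : Admissible v g₂ C)
  (hC : 0 ≤ C) {η₀ : ℝ} (hη₀ : 0 ≤ η₀) (hclose : ∀ x, 0 < v x → ‖g₂ x - g₁ x‖ ≤ η₀)
  {ε : ℝ} (hε : 0 < ε) (hvε : ∀ x, v x ≤ ε)
  (hI : ∫⁻ x, admWeight v d x ∂S.variation ≠ ⊤)

omit [FiniteDimensional ℝ V] [MeasurableSpace V] [BorelSpace V] in
include hcyc in
/-- A cycle has boundary of finite (zero) mass. [folklore] -/
theorem Current.boundary_mass_ne_top_of_cycle : S.boundary.mass ≠ ⊤ := by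
  rw [hcyc, Current.mass_zero]; exact ENNReal.zero_ne_top

include hcyc in
/-- For a cycle, `∂(S ⌞ {v > r}) = −⟨S, v, r+⟩`. [cite: Federer1969, 4.2.1] -/
theorem Current.boundary_restrictAbove_of_cycle (r : ℝ) :
    (S.restrictAbove hS hv.continuous r).boundary =
      -((S.isRepresentable_of_mass_ne_top hS).slice
        (S.boundary.isRepresentable_of_mass_ne_top (S.boundary_mass_ne_top_of_cycle hcyc)) hv.continuous r) := by
  have h0 : (S.boundary.isRepresentable_of_mass_ne_top (S.boundary_mass_ne_top_of_cycle hcyc)).restrictSet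
      {x | r < v x} (measurableSet_lt_of_continuous hv.continuous r) = 0 := by
    refine Current.eq_zero_of_mass_eq_zero _ (le_antisymm ?_ bot_le)
    refine ((S.boundary.isRepresentable_of_mass_ne_top (S.boundary_mass_ne_top_of_cycle hcyc)).mass_restrictSet_le
      _).trans ?_
    refine (Current.variation_le_mass _ _).trans ?_
    rw [hcyc, Current.mass_zero]
  simp only [Current.IsRepresentable.slice, Current.restrictAbove, h0, zero_sub, neg_neg]

include hcyc in
/-- **`∂(g_{#v} S) = 0` for a cycle `S`** (every degree): `𝐌(∂ P_{r_j}) ≤ (extConst r_j)^d 𝐌⟨S, v, r_j+⟩ → 0`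
along a good sequence with slice decay. [cite: Federer1969, 4.2.2] -/
theorem Current.boundary_admPushLim_of_cycle {P : ℝ → Prop} (R : S.GoodSeq hS hv.continuous ε P) :
    (S.admPushLim b hS hsupp hv.continuous hadm hC hε R hvε hI).boundary = 0 := by
  have hdS := S.boundary_mass_ne_top_of_cycle hcyc
  obtain ⟨P', R', -, hdecay⟩ := S.exists_goodSeq_decay' (n := n) hS hdS hv hε hI hC (Q := fun _ => True)
    (Eventually.of_forall fun _ => trivial)
  rw [S.admPushLim_eq b hS hsupp hv.continuous hadm hC hε R hvε hI R']
  set hT := S.isRepresentable_of_mass_ne_top hS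
  set hdT := S.boundary.isRepresentable_of_mass_ne_top hdS
  ext ψ
  rw [Current.boundary_apply]
  show _ = (0 : ℝ)
  have t1 := S.tendsto_admPush b hS hsupp hv.continuous hadm hC hε R' hvε hI (TestForm.extDerivCLM ψ)
  -- the boundary masses
  obtain ⟨Cψ, hCψ, hψ⟩ := ψ.exists_norm_le
  have hbm : ∀ j, (S.admPush b hS hsupp hv.continuous hadm hC (R'.pos hε j) (R'.good j)).boundary.mass ≤
      (extConst n C (R'.r j) : ℝ≥0∞) ^ d * (hT.slice hdT hv.continuous (R'.r j)).mass := by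
    intro j
    unfold Current.admPush
    refine (Current.mass_boundary_lipPushforward_le' _ _ _ _ _).trans ?_
    rw [S.boundary_restrictAbove_of_cycle hS hcyc hv, Current.mass_neg]
  have hfin : ∀ j, (S.admPush b hS hsupp hv.continuous hadm hC (R'.pos hε j) (R'.good j)).boundary.mass ≠ ⊤ := by
    intro j
    refine ne_top_of_le_ne_top ?_ (hbm j)
    refine ENNReal.mul_ne_top (ENNReal.pow_ne_top ENNReal.coe_ne_top) ?_
    have := R'.good j
    rwa [S.boundary_restrictAbove_of_cycle hS hcyc hv, Current.mass_neg] at this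
  have hlim0 : Tendsto (fun j => (S.admPush b hS hsupp hv.continuous hadm hC (R'.pos hε j) (R'.good j)).boundary.mass)
      atTop (𝓝 0) :=
    tendsto_of_tendsto_of_tendsto_of_le_of_le tendsto_const_nhds hdecay (fun j => bot_le) hbm
  have t2 : Tendsto (fun j => S.admPush b hS hsupp hv.continuous hadm hC (R'.pos hε j) (R'.good j)
      (TestForm.extDerivCLM ψ)) atTop (𝓝 0) := by
    have hlim' : Tendsto (fun j => Cψ * ((S.admPush b hS hsupp hv.continuous hadm hC (R'.pos hε j)
        (R'.good j)).boundary.mass).toReal) atTop (𝓝 0) := by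
      have := ((ENNReal.tendsto_toReal ENNReal.zero_ne_top).comp hlim0).const_mul Cψ
      simpa using this
    refine squeeze_zero_norm' (Eventually.of_forall fun j => ?_) hlim'
    rw [Real.norm_eq_abs, ← Current.boundary_apply]
    exact Current.abs_apply_le_mul_toReal_mass' _ (hfin j) hCψ.le hψ
  exact tendsto_nhds_unique t1 t2

include hcyc hη₀ hclose in
/-- **The homotopy formula for a cycle `S`** (every degree):
`(g₂)_{#v} S − (g₁)_{#v} S = ∂ H_v(g₁, g₂) S` — the error currents
`(G²_r)_# X_r − (G¹_r)_# X_r − ∂ H(G¹_r, G²_r) X_r` have mass `≤ √n η₀ (15 extConst r)^d 𝐌⟨S, v, r+⟩ → 0`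
along a good sequence with slice decay. [cite: Federer1969, 4.1.9, 4.2.2] -/
theorem Current.admPushLim_sub_admPushLim_eq_of_cycle {P₁ P₂ P₃ : ℝ → Prop}
    (R₁ : S.GoodSeq hS hv.continuous ε P₁) (R₂ : S.GoodSeq hS hv.continuous ε P₂)
    (R₃ : S.GoodSeq hS hv.continuous ε P₃) :
    S.admPushLim b hS hsupp hv.continuous h₂ hC hε R₂ hvε hI - S.admPushLim b hS hsupp hv.continuous h₁ hC hε R₁ hvε hI =
      (S.admHomLim b hS hsupp hv.continuous h₁ h₂ hC hη₀ hclose hε R₃ hvε hI).boundary := by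
  have hdS := S.boundary_mass_ne_top_of_cycle hcyc
  obtain ⟨P', R', -, hdecay⟩ := S.exists_goodSeq_decay' (n := n) hS hdS hv hε hI hC (Q := fun _ => True)
    (Eventually.of_forall fun _ => trivial)
  rw [S.admPushLim_eq b hS hsupp hv.continuous h₂ hC hε R₂ hvε hI R',
    S.admPushLim_eq b hS hsupp hv.continuous h₁ hC hε R₁ hvε hI R',
    S.admHomLim_eq b hS hsupp hv.continuous h₁ h₂ hC hη₀ hclose hε R₃ hvε hI R']
  set hT := S.isRepresentable_of_mass_ne_top hS
  set hdT := S.boundary.isRepresentable_of_mass_ne_top hdS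
  -- the error currents at the radii `r_j`
  have hkey : ∀ j, ∃ Ej : Current (⊤ : Opens V) (d + 1),
      S.admPush b hS hsupp hv.continuous h₂ hC (R'.pos hε j) (R'.good j) -
        S.admPush b hS hsupp hv.continuous h₁ hC (R'.pos hε j) (R'.good j) -
        (S.admHom b hS hsupp hv.continuous h₁ h₂ hC hη₀ hclose (R'.pos hε j) (R'.good j)).boundary = Ej ∧
      Ej.mass ≤ ENNReal.ofReal (Real.sqrt n * η₀ * (5 * max ((extConst n C (R'.r j) : ℝ≥0) : ℝ)
        ((3 * extConst n C (R'.r j) : ℝ≥0) : ℝ)) ^ d) * (hT.slice hdT hv.continuous (R'.r j)).mass := by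
    intro j
    set r := R'.r j
    have hr : 0 < r := R'.pos hε j
    have hgood := R'.good j
    set X := S.restrictAbove hS hv.continuous r with hX
    have hXm : X.mass ≠ ⊤ := S.mass_restrictAbove_ne_top hS hv.continuous r
    have hXc : IsCompact X.support := S.isCompact_support_restrictAbove hS hsupp hv.continuous r
    have hP2 : S.admPush b hS hsupp hv.continuous h₂ hC hr hgood =
        X.lipPushforward hXm hgood hXc (h₁.lipschitzWith_ext₂ b h₂ hC hη₀ hclose hr) ⊤ := by
      unfold Current.admPush
      refine X.lipPushforward_congr hXm hgood hXc (h₂.lipschitzWith_ext b hC hr)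
        (h₁.lipschitzWith_ext₂ b h₂ hC hη₀ hclose hr) (N := {x | r / 2 < v x}) (isOpen_lt continuous_const hv.continuous)
        ((S.support_restrictAbove_subset hS hv.continuous r).trans fun x hx => ?_) fun x hx => ?_
      · show r / 2 < v x
        have : r ≤ v x := hx
        linarith
      · have hx' : r / 2 < v x := hx
        rw [h₂.ext_eqOn b hC hr hx'.le, h₁.ext₂_eqOn b h₂ hC hη₀ hclose hr hx'.le]
    refine ⟨_, rfl, ?_⟩
    rw [hP2]
    unfold Current.admPush Current.admHom
    refine (X.mass_lipHomotopyError_le hXm hgood hXc (h₁.lipschitzWith_ext b hC hr)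
      (h₁.lipschitzWith_ext₂ b h₂ hC hη₀ hclose hr) (sqrt_mul_nonneg n hη₀)
      (h₁.norm_ext₂_sub_ext_le b h₂ hC hη₀ hclose hr)).trans ?_
    rw [hX, S.boundary_restrictAbove_of_cycle hS hcyc hv, Current.mass_neg]
  choose Ej hEj hEjm using hkey
  -- the error masses tend to zero
  have hbound : ∀ j, (Ej j).mass ≤ ENNReal.ofReal (Real.sqrt n * η₀ * 15 ^ d) *
      ((extConst n C (R'.r j) : ℝ≥0∞) ^ d * (hT.slice hdT hv.continuous (R'.r j)).mass) := by
    intro j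
    refine (hEjm j).trans ?_
    rw [← mul_assoc]
    refine mul_le_mul' (le_of_eq ?_) le_rfl
    have he : 0 ≤ ((extConst n C (R'.r j) : ℝ≥0) : ℝ) := NNReal.coe_nonneg _
    have hmax : max ((extConst n C (R'.r j) : ℝ≥0) : ℝ) ((3 * extConst n C (R'.r j) : ℝ≥0) : ℝ) =
        3 * ((extConst n C (R'.r j) : ℝ≥0) : ℝ) := by
      rw [NNReal.coe_mul]; push_cast
      exact max_eq_right (by nlinarith)
    rw [hmax, show 5 * (3 * ((extConst n C (R'.r j) : ℝ≥0) : ℝ)) = 15 * ((extConst n C (R'.r j) : ℝ≥0) : ℝ) by ring,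
      mul_pow, ← mul_assoc, ENNReal.ofReal_mul (by positivity), ← ENNReal.ofReal_coe_nnreal,
      ENNReal.ofReal_pow he]
  have hlim0 : Tendsto (fun j => (Ej j).mass) atTop (𝓝 0) := by
    have := ENNReal.Tendsto.const_mul (a := ENNReal.ofReal (Real.sqrt n * η₀ * 15 ^ d)) hdecay
      (Or.inr ENNReal.ofReal_ne_top)
    rw [mul_zero] at this
    exact tendsto_of_tendsto_of_tendsto_of_le_of_le tendsto_const_nhds this (fun j => bot_le) hbound
  have hfin : ∀ j, (Ej j).mass ≠ ⊤ := fun j => ne_top_of_le_ne_top (ENNReal.mul_ne_top ENNReal.ofReal_ne_top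
    (ENNReal.mul_ne_top (ENNReal.pow_ne_top ENNReal.coe_ne_top) (by
      have := R'.good j
      rwa [S.boundary_restrictAbove_of_cycle hS hcyc hv, Current.mass_neg] at this))) (hbound j)
  ext ψ
  have t1 := ((S.tendsto_admPush b hS hsupp hv.continuous h₂ hC hε R' hvε hI ψ).sub
    (S.tendsto_admPush b hS hsupp hv.continuous h₁ hC hε R' hvε hI ψ)).sub
    (S.tendsto_admHom b hS hsupp hv.continuous h₁ h₂ hC hη₀ hclose hε R' hvε hI (TestForm.extDerivCLM ψ))
  obtain ⟨Cψ, hCψ, hψ⟩ := ψ.exists_norm_le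
  have t2 : Tendsto (fun j => Ej j ψ) atTop (𝓝 0) := by
    have hlim' : Tendsto (fun j => Cψ * ((Ej j).mass).toReal) atTop (𝓝 0) := by
      have := ((ENNReal.tendsto_toReal ENNReal.zero_ne_top).comp hlim0).const_mul Cψ
      simpa using this
    refine squeeze_zero_norm' (Eventually.of_forall fun j => ?_) hlim'
    rw [Real.norm_eq_abs]
    exact Current.abs_apply_le_mul_toReal_mass' _ (hfin j) hCψ.le hψ
  have t2' : Tendsto (fun j => S.admPush b hS hsupp hv.continuous h₂ hC (R'.pos hε j) (R'.good j) ψ -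
      S.admPush b hS hsupp hv.continuous h₁ hC (R'.pos hε j) (R'.good j) ψ -
      (S.admHom b hS hsupp hv.continuous h₁ h₂ hC hη₀ hclose (R'.pos hε j) (R'.good j)) (TestForm.extDerivCLM ψ))
      atTop (𝓝 0) := by
    refine t2.congr fun j => ?_
    have := DFunLike.congr_fun (hEj j) ψ
    rw [← this]
    rfl
  have h0 := tendsto_nhds_unique t1 t2'
  rw [show (S.admPushLim b hS hsupp hv.continuous h₂ hC hε R' hvε hI - S.admPushLim b hS hsupp hv.continuous h₁ hC hε R' hvε hI) ψ =
      S.admPushLim b hS hsupp hv.continuous h₂ hC hε R' hvε hI ψ - S.admPushLim b hS hsupp hv.continuous h₁ hC hε R' hvε hI ψ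
      from rfl, Current.boundary_apply]
  linarith

end AdmissibleCycle

end Literature.Geometry.GeometricMeasureTheory
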